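import Summits.ValiantsHypothesis.ValiantsHypothesis.Theorems.GrenetZeonDualUnipotentThreeHalvesHeavyTopCodimOneArith
import Literature.NumberTheory.Waring.PolygonalNumberTheorem

/-!
# `GrenetZeon.DualUnipotentThreeHalves` (stmt-ValiantsHypothesis-24318), R2 heavy-top instrument — COROLLARY II port, step (c1):
# the POSITION COUNT for ANY number of levels, `C(m,2) = Σ_t C(s_t,2) + #{(i,j) : lvl j < lvl i}`

Companion arithmetic of the general graded count ✓ `…HeavyTopCodimOneCountLevels.finrank_le_of_levels` (general form of
✓ `…HeavyTopCodimOneArith.choose_two_eq_three_levels`): for `lvl : Fin m → ℕ` with values `< L` and `s_t = #{i : lvl i = t}`,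

* `card_fin_eq_sum_levels` — `m = Σ_{t<L} s_t`;
* `card_pairs_eq` — `m² = #{lvl j < lvl i} + #{lvl i < lvl j} + #{lvl i = lvl j}`, `card_pattern_swap` — the first two agree,
  `card_pairs_same_level` — `#{lvl i = lvl j} = Σ_t s_t²`;
* ★ `choose_two_eq_sum_levels` — `C(m,2) = Σ_{t<L} C(s_t,2) + #{(i,j) : lvl j < lvl i}` (by doubling, with ✓ `two_mul_choose_two_add`).

So «`dim V + 1 = C(m,2)`» and the graded count say: the block deficiencies `C(s_t,2) − dim W_t` (table ✓ `…HeavyTopCodimOneBlocks`) sum to `≤ 1`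
over ALL levels — no block of size `2` or `≥ 4`, at most one of size `3` (crux note `CENSUS-THMC-UNIFORM-eng1g5.md` §8, composition-chain route).

Honest framing: counting; nothing here proves or refutes `HeavyTopLaw`, 24318, S3b or 8062; `VP ≠ VNP` is NOT proved.  No definitions.
[folklore; cell val-heavytop-census, eng-1 g5]
-/

noncomputable section

-- single-conjunct layout: Sub = Summit, duplicated namespace component intended
set_option linter.dupNamespace false

namespace Summit.ValiantsHypothesis.ValiantsHypothesis.Theorems.GrenetZeon.HeavyTopCodimOneArith

open Literature.NumberTheory.Waring.PolygonalNumberTheorem (two_mul_choose_two_add)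

/-- `m = Σ_{t<L} s_t`. -/
theorem card_fin_eq_sum_levels {m L : ℕ} (lvl : Fin m → ℕ) (hlvl : ∀ i, lvl i < L) :
    m = ∑ t ∈ Finset.range L, Fintype.card {i : Fin m // lvl i = t} := by
  classical
  have hmaps : ((Finset.univ : Finset (Fin m)) : Set (Fin m)).MapsTo lvl (Finset.range L : Finset ℕ) := by
    intro i _
    rw [Finset.coe_range, Set.mem_Iio]
    exact hlvl i
  have h := Finset.card_eq_sum_card_fiberwise hmaps
  rw [Finset.card_univ, Fintype.card_fin] at h
  exact h.trans (Finset.sum_congr rfl fun t _ => by rw [Fintype.card_subtype])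

/-- `m² = #{lvl j < lvl i} + #{lvl i < lvl j} + #{lvl i = lvl j}`. -/
theorem card_pairs_eq {m : ℕ} (lvl : Fin m → ℕ) :
    m * m = Fintype.card {x : Fin m × Fin m // lvl x.2 < lvl x.1} + Fintype.card {x : Fin m × Fin m // lvl x.1 < lvl x.2} +
      Fintype.card {x : Fin m × Fin m // lvl x.1 = lvl x.2} := by
  classical
  rw [Fintype.card_subtype, Fintype.card_subtype, Fintype.card_subtype]
  have hsplit : (Finset.univ : Finset (Fin m × Fin m)) =
      ((Finset.univ.filter fun x : Fin m × Fin m => lvl x.2 < lvl x.1) ∪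
        (Finset.univ.filter fun x : Fin m × Fin m => lvl x.1 < lvl x.2)) ∪
        (Finset.univ.filter fun x : Fin m × Fin m => lvl x.1 = lvl x.2) := by
    ext x
    simp only [Finset.mem_univ, Finset.mem_union, Finset.mem_filter, true_and, true_iff]
    omega
  have hd1 : Disjoint (Finset.univ.filter fun x : Fin m × Fin m => lvl x.2 < lvl x.1)
      (Finset.univ.filter fun x : Fin m × Fin m => lvl x.1 < lvl x.2) :=
    Finset.disjoint_filter.2 fun x _ h h' => by omega
  have hd2 : Disjoint ((Finset.univ.filter fun x : Fin m × Fin m => lvl x.2 < lvl x.1) ∪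
      (Finset.univ.filter fun x : Fin m × Fin m => lvl x.1 < lvl x.2))
      (Finset.univ.filter fun x : Fin m × Fin m => lvl x.1 = lvl x.2) := by
    rw [Finset.disjoint_union_left]
    exact ⟨Finset.disjoint_filter.2 fun x _ h h' => by omega, Finset.disjoint_filter.2 fun x _ h h' => by omega⟩
  have h := congrArg Finset.card hsplit
  rw [Finset.card_univ, Fintype.card_prod, Fintype.card_fin, Finset.card_union_of_disjoint hd2, Finset.card_union_of_disjoint hd1] at h
  exact h

/-- The two strict patterns have the same size (swap the coordinates). -/
theorem card_pattern_swap {m : ℕ} (lvl : Fin m → ℕ) :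
    Fintype.card {x : Fin m × Fin m // lvl x.1 < lvl x.2} = Fintype.card {x : Fin m × Fin m // lvl x.2 < lvl x.1} :=
  Fintype.card_congr ((Equiv.prodComm (Fin m) (Fin m)).subtypeEquiv fun _ => Iff.rfl)

/-- `#{lvl i = lvl j} = Σ_{t<L} s_t²`. -/
theorem card_pairs_same_level {m L : ℕ} (lvl : Fin m → ℕ) (hlvl : ∀ i, lvl i < L) :
    Fintype.card {x : Fin m × Fin m // lvl x.1 = lvl x.2} =
      ∑ t ∈ Finset.range L, Fintype.card {i : Fin m // lvl i = t} * Fintype.card {i : Fin m // lvl i = t} := by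
  classical
  rw [Fintype.card_subtype]
  have hmaps : ((Finset.univ.filter fun x : Fin m × Fin m => lvl x.1 = lvl x.2 : Finset (Fin m × Fin m)) : Set (Fin m × Fin m)).MapsTo
      (fun x => lvl x.1) (Finset.range L : Finset ℕ) := by
    intro x _
    rw [Finset.coe_range, Set.mem_Iio]
    exact hlvl x.1
  rw [Finset.card_eq_sum_card_fiberwise hmaps]
  refine Finset.sum_congr rfl fun t _ => ?_
  rw [← card_pairs_levels, Finset.filter_filter]
  congr 1
  exact Finset.filter_congr fun x _ => by constructor <;> rintro ⟨h1, h2⟩ <;> exact ⟨by omega, by omega⟩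

/-- ★ **`C(m, 2) = Σ_{t<L} C(s_t, 2) + #{(i, j) : lvl j < lvl i}`** for any level function with values `< L`. [folklore] -/
theorem choose_two_eq_sum_levels {m L : ℕ} (lvl : Fin m → ℕ) (hlvl : ∀ i, lvl i < L) :
    m.choose 2 = ∑ t ∈ Finset.range L, (Fintype.card {i : Fin m // lvl i = t}).choose 2 +
      Fintype.card {x : Fin m × Fin m // lvl x.2 < lvl x.1} := by
  have hm := two_mul_choose_two_add m
  have hsq : m ^ 2 = m * m := sq m
  have hpairs := card_pairs_eq lvl
  have hswap := card_pattern_swap lvl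
  have hsame := card_pairs_same_level lvl hlvl
  have hfin := card_fin_eq_sum_levels lvl hlvl
  -- double every level: `Σ s_t² = 2 Σ C(s_t,2) + Σ s_t`
  have hlev : ∑ t ∈ Finset.range L, Fintype.card {i : Fin m // lvl i = t} * Fintype.card {i : Fin m // lvl i = t} =
      2 * ∑ t ∈ Finset.range L, (Fintype.card {i : Fin m // lvl i = t}).choose 2 +
        ∑ t ∈ Finset.range L, Fintype.card {i : Fin m // lvl i = t} := by
    rw [Finset.mul_sum, ← Finset.sum_add_distrib]
    exact Finset.sum_congr rfl fun t _ => by rw [two_mul_choose_two_add, sq]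
  omega

end Summit.ValiantsHypothesis.ValiantsHypothesis.Theorems.GrenetZeon.HeavyTopCodimOneArith

end
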